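import Mathlib.RingTheory.Length
import Literature.RingTheory.Length.TorsionSnake
import HarnessLib

/-!
# Length bookkeeping behind "zeta element ⇒ equivalence of main conjectures" (four-term sequences with cokernel corrections)

Companion to `Literature/NumberTheory/EllipticCurves/IwasawaDivisibilityTransfer.lean` (cell `bsd-ssimc`,
seat `bsd-ssimc-bstw`; referee request W-bstw-1 of `run/shared/lean/pub/bsd-ssimc/bsd-ssimc-ref/REPORT-bstw-1.md`).
Pure module theory over a commutative ring, sorry-free; nothing about elliptic curves is asserted.

The proof of Burungale–Skinner–Tian–Wan, *Zeta elements for elliptic curves and applications*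
(arXiv:2409.01350v2) Part II Prop. 1.18 = §9.3.2 (ordinary case), on which Burungale–Castella–Skinner,
IMRN 2025, Thm. 4.1.3 rests, compares characteristic ideals along TWO four-term exact sequences of finitely
generated torsion modules over a two-variable Iwasawa algebra `Λ` that share their outer terms,
`0 → A → B₁ → C₁ → D → 0` and `0 → A → B₂ → C₂ → D → 0` (Poitou–Tate), in which the inner-left terms are
identified, via Coleman / big-logarithm maps that are injective with PSEUDO-NULL cokernel
(Kings–Loeffler–Zerbes, Camb. J. Math. 5 (2017), Thm. 8.2.3 and Rem. 8.2.4), with submodules of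
`Λ/(L₁)` resp. `e⁻¹Λ/(L₂)` for the two `p`-adic `L`-functions `L₁, L₂` and a constant `e ∈ Λ` coming
from the integral normalisations. "Characteristic ideal" bookkeeping is, prime by prime, LENGTH bookkeeping:
for a height-one prime `P` of `Λ`, `ord_P char(M) = length_{Λ_P}(M_P)`, localisation is exact, and a
pseudo-null module has length `0` at every height-one prime. This file proves exactly the length
identities used there, in Mathlib's `Module.length` (values in `ℕ∞`, no finiteness needed for the
identities themselves):

* `length_four_term` — for an exact `0 → M₁ → M₂ → M₃ → M₄ → 0`, `ℓ(M₁) + ℓ(M₃) = ℓ(M₂) + ℓ(M₄)`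
  (the four-term case of the alternating-sum identity; cf. `Literature.RingTheory.Length.length_six_term`,
  Fulton, *Intersection Theory*, Lemma A.1.1);
* `length_eq_of_injective_of_length_quotient_eq_zero` — an injection whose cokernel has length `0`
  (e.g. the localisation at a height-one prime of an injection with pseudo-null cokernel) preserves length;
  `length_eq_add_length_quotient_of_injective` — the general correction term;
* `ordTransfer_of_four_term` — the resulting transfer of inequalities between the `P`-orders, stated in `ℕ`
  (all lengths being finite for torsion modules at height-one primes): with `a + c₁ = l₁ + d` and
  `a + c₂ = (l₂ + e) + d` one has `l₁ ≤ c₁ ↔ l₂ + e ≤ c₂`, hence `l₁ ≤ c₁ → l₂ ≤ c₂` UNCONDITIONALLY in the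
  constant `e ≥ 0`, while the converse direction and the equality case see `e`. This is the precise
  integral content of "the same conclusion holds for the opposite divisibilities, and before inverting `p`"
  (BCS Thm. 4.1.3): the direction Greenberg-divisibility ⇒ standard-divisibility is insensitive to the
  normalising constant, the other direction holds after inverting `p` (where `e` becomes a unit) or when
  `e` is a unit.

References: BSTW arXiv:2409.01350v2 §9.3.2 (Prop. 9.18); BCS, IMRN 2025 rnaf082, Thm. 4.1.3;
KLZ, Camb. J. Math. 5 (2017) §8.2; Bourbaki, *Commutative Algebra* VII §4.4–4.5; Fulton,
*Intersection Theory*, App. A.1. Memo: `run/shared/lean/pub/bsd-ssimc/bstw-MEMO-2.md` Part A.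
-/

open Function

namespace Literature.NumberTheory.EllipticCurves.IwasawaTransfer

section FourTerm

variable {R : Type*} [CommRing R]
  {M₁ M₂ M₃ M₄ : Type*}
  [AddCommGroup M₁] [Module R M₁] [AddCommGroup M₂] [Module R M₂]
  [AddCommGroup M₃] [Module R M₃] [AddCommGroup M₄] [Module R M₄]

/-- **Four-term length identity.** For an exact sequence `0 → M₁ → M₂ → M₃ → M₄ → 0` of modules over
a commutative ring, `ℓ(M₁) + ℓ(M₃) = ℓ(M₂) + ℓ(M₄)` in `ℕ∞` (split at the image of the middle map and
use additivity of length twice). Applied, after localising at a height-one prime `P`, to the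
Poitou–Tate sequences `0 → H¹_{rel,ord}/Λ𝒵 → B → X_? → X_{st,ord} → 0` of BSTW Prop. 9.18 / BCS
Thm. 4.1.3 it is the identity `ord_P char(A) + ord_P char(C) = ord_P char(B) + ord_P char(D)`.
[cite: Fulton1998, Lemma A.1.1] [cite: BurungaleCastellaSkinner2025, Thm. 4.1.3 (proof: "a pair of
four-term exact sequences coming from Poitou–Tate duality")] -/
theorem length_four_term (f₁ : M₁ →ₗ[R] M₂) (f₂ : M₂ →ₗ[R] M₃) (f₃ : M₃ →ₗ[R] M₄)
    (h₁ : Injective f₁) (h₂ : Exact f₁ f₂) (h₃ : Exact f₂ f₃) (h₄ : Surjective f₃) :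
    Module.length R M₁ + Module.length R M₃ = Module.length R M₂ + Module.length R M₄ := by
  have e₂ := Literature.RingTheory.Length.length_eq_length_ker_add_length_range f₂
  have e₃ := Literature.RingTheory.Length.length_eq_length_ker_add_length_range f₃
  rw [(LinearMap.exact_iff.mp h₂ : LinearMap.ker f₂ = _)] at e₂
  rw [(LinearMap.exact_iff.mp h₃ : LinearMap.ker f₃ = _)] at e₃
  have r₁ : Module.length R (LinearMap.range f₁) = Module.length R M₁ :=
    (LinearEquiv.ofInjective f₁ h₁).length_eq.symm
  have r₃ : Module.length R (LinearMap.range f₃) = Module.length R M₄ := by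
    rw [LinearMap.range_eq_top.mpr h₄]
    exact Submodule.topEquiv.length_eq
  rw [r₁] at e₂
  rw [r₃] at e₃
  rw [e₂, e₃]
  ring

/-- **Length along an injection, with the cokernel correction.** If `f : M₁ → M₂` is injective then
`ℓ(M₂) = ℓ(M₁) + ℓ(M₂ / f(M₁))`. In BSTW §9.3.2 this is applied to the injective Coleman / big-logarithm
maps `H¹_{/ord}(L_v, T ⊗ Λ_L)/Λ·loc_v 𝒵 ↪ e⁻¹Λ/(𝓛_p)` and `H¹_{ord}(L_v̄, T ⊗ Λ_L^{ur})/loc_v̄ 𝒵 ↪ Λ^{ur}/(𝓛_p^{Gr})`,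
whose cokernels are the cokernels of the Kings–Loeffler–Zerbes maps. [cite: KingsLoefflerZerbes2017,
Thm. 8.2.3 and Rem. 8.2.4] -/
theorem length_eq_add_length_quotient_of_injective (f : M₁ →ₗ[R] M₂) (hf : Injective f) :
    Module.length R M₂ = Module.length R M₁ + Module.length R (M₂ ⧸ LinearMap.range f) :=
  Module.length_eq_add_of_exact f (LinearMap.range f).mkQ hf (Submodule.mkQ_surjective _)
    (LinearMap.exact_map_mkQ_range f)

/-- **Pseudo-null cokernels are invisible.** If `f : M₁ → M₂` is injective and its cokernel has length
`0` (at a height-one prime `P`: the cokernel is pseudo-null, so its localisation at `P` vanishes), then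
`ℓ(M₁) = ℓ(M₂)`. This is the sentence "finite resp. pseudo-null cokernels do not change characteristic
ideals" of the verification memo, prime by prime. (Bourbaki, *Commutative Algebra* VII §4.4 Thm. 5, §4.5). [cite: KingsLoefflerZerbes2017, Rem. 8.2.4] -/
theorem length_eq_of_injective_of_length_quotient_eq_zero (f : M₁ →ₗ[R] M₂) (hf : Injective f)
    (h0 : Module.length R (M₂ ⧸ LinearMap.range f) = 0) :
    Module.length R M₁ = Module.length R M₂ := by
  rw [length_eq_add_length_quotient_of_injective f hf, h0, add_zero]

end FourTerm

section OrdTransfer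

/-- **Transfer of `P`-orders along two four-term sequences with common outer terms** (the arithmetic
of BSTW Prop. 9.18 / BCS Thm. 4.1.3 at one height-one prime `P`, all lengths finite and written in `ℕ`).
Notation: `a = ord_P char(H¹_{rel,ord}/Λ𝒵)`, `d = ord_P char(X_{st,ord})`, `c₁ = ord_P char(X_Gr)`,
`c₂ = ord_P char(X)`, `l₁ = ord_P 𝓛_p^{Gr}`, `l₂ = ord_P 𝓛_p`, and `e = ord_P` of the normalising
constant by which the image of the integral Coleman map at `v` fails to be all of `Λ` (`e = 0` when that
constant is a unit, always `e = 0` after inverting `p` for a constant in `𝒪`); the hypotheses are the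
two four-term identities once the inner-left terms have been identified with `Λ/(𝓛_p^{Gr})` and
`e⁻¹Λ/(𝓛_p)` up to pseudo-null error. Conclusions: the lower bound `𝓛_p^{Gr} ∣ char X_Gr` at `P`
is EQUIVALENT to `e·𝓛_p ∣ char X` at `P`, hence IMPLIES `𝓛_p ∣ char X` at `P` whatever `e` is; the
upper bounds and the equalities correspond likewise with the shift `e`. [cite: BurungaleCastellaSkinner2025,
Thm. 4.1.3 ("The same conclusion holds for the opposite divisibilities, and before inverting p")] -/
theorem ordTransfer_of_four_term {a c₁ c₂ d l₁ l₂ e : ℕ}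
    (h₁ : a + c₁ = l₁ + d) (h₂ : a + c₂ = (l₂ + e) + d) :
    (l₁ ≤ c₁ ↔ a ≤ d) ∧ (l₁ ≤ c₁ ↔ l₂ + e ≤ c₂) ∧ (l₁ ≤ c₁ → l₂ ≤ c₂) ∧
      (c₁ ≤ l₁ ↔ d ≤ a) ∧ (c₁ ≤ l₁ ↔ c₂ ≤ l₂ + e) ∧ (c₂ ≤ l₂ → c₁ ≤ l₁) ∧
      (l₁ = c₁ ↔ a = d) ∧ (l₁ = c₁ ↔ l₂ + e = c₂) := by
  omega

/-- The symmetric special case `e = 0` (unit normalising constant, or after inverting `p`): along the two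
four-term sequences every one-sided divisibility and the equality transfer verbatim between the two main
conjectures, prime by prime. [cite: BurungaleCastellaSkinner2025, Thm. 4.1.3] -/
theorem ordTransfer_of_four_term_zero {a c₁ c₂ d l₁ l₂ : ℕ}
    (h₁ : a + c₁ = l₁ + d) (h₂ : a + c₂ = l₂ + d) :
    (l₁ ≤ c₁ ↔ l₂ ≤ c₂) ∧ (c₁ ≤ l₁ ↔ c₂ ≤ l₂) ∧ (l₁ = c₁ ↔ l₂ = c₂) := by
  omega

end OrdTransfer

end Literature.NumberTheory.EllipticCurves.IwasawaTransfer
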